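import Summits.QuantumAdvantage.QuantumAdvantage.Theorems.OddPrimeWalkSignWalkSites

/-!
# OddPrimeWalk — the SIGN-WALK FLOOR on `ℤ₃` (item stmt-QuantumAdvantage-24332 `SignWalkFloorThree`)

Route OddPrimeWalk (planner qa-qnc0-p2 g32, PROOF-BB); prover qn-prover-3 g20.  `oddPrimeWalk_signWalkFloorThree` (route-file
signature verbatim): `Σ_{b ∈ {0,1}^k} Π_{j ∈ A} (2[z_j + z_k = x_j] − 1) ≥ −(1/3 + ε)·2^k` for `k ≥ k₀(ε)`, `z_j = #{i<j : b_i}` mod 3.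
PROOF (one free block suffices).  `bbSum_eq_sum_evo`: the sum is `Σ_{w ∈ ℤ₃}` of transfer products of the `0/+1` walk with site
factors `2[z + w = x_j] − 1` (reflections in `z` AND in `w`; machinery `OddPrimeWalkSignWalkCore/Bounds`).  DENSE
(`abs_bbSum_le_of_dense`): `≥ 16` interior active sites ⇒ `8` of one parity, pairwise non-adjacent, each owning the sandwich
`P(2δ_c−1)P` of norm² `≤ ½` ⇒ every endpoint term `≤ 2^k/16`, `|Σ| ≤ 3·2^k/16 < 2^k/3`.  SPARSE (`bbSum_ge_of_gap`): a block of `ℓ`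
inactive sites splits the evolution (prefix ∘ free block ∘ suffix); the free block is convolution with the weight counts `cnt ℓ` of
`{0,1}^ℓ` mod 3 `= 2^ℓ/3 ± 2/3`; the rank-one main term is `(2^ℓ/3)·Σ_{b₁,b₂} Σ_w P(w)` with `P` a `±1`-valued product of
reflections in `w` (prefix: `2[p + w = x] − 1`; suffix from the free start `w − |b₂|`: `2[2w = c] − 1 = 2[w = 2c] − 1`) with
`Π_w P(w) = 1`, so `Σ_w P(w) ≥ −1` (`pm_sum_ge`) and the main term is `≥ −2^k/3`; the error is `≤ 2·2^k/2^ℓ` by the growth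
bounds.  ASSEMBLY: `k₀ = 16ℓ + 1`, `2·2^{−ℓ} ≤ ε`; `< 16` interior sites leave one of the blocks `[qℓ+1, qℓ+ℓ]`, `q < 16`, free.
WHAT THIS IS NOT: no ring-game statement; (R₁) / item 24200 untouched; separation NOT moved.
-/

namespace Summit.QuantumAdvantage.AdviceFreeQNC0.SignWalk

open Finset

/-! ### Dense case: many interior active sites -/

/-- **Dense bound**: `8` interior active sites of one parity force `|⟨δ_w, evo⟩| ≤ 2^k/16` for every endpoint `w`. -/
theorem abs_evo_le_of_parity_class (k : ℕ) (A : Finset (Fin (k + 1))) (x : Fin (k + 1) → ZMod 3) (par : ℕ)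
    (h8 : 8 ≤ ((interior k A).filter fun j => j.val % 2 = par).card) (w : ZMod 3) :
    |evo k (FA k A x w) (v0 k A x w) w| ≤ (2 : ℝ) ^ k / 16 := by
  set P := (interior k A).filter fun j => j.val % 2 = par with hP
  set S : Finset ℕ := P.image Fin.val with hS
  have hScard : S.card = P.card := card_image_of_injective _ Fin.val_injective
  have hmemS : ∀ c ∈ S, ∃ j : Fin (k + 1), j ∈ A ∧ j.val = c ∧ 1 ≤ c ∧ c + 1 ≤ k ∧ c % 2 = par := by
    intro c hc
    rw [hS, mem_image] at hc
    obtain ⟨j, hj, rfl⟩ := hc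
    rw [hP, mem_filter, interior, mem_filter] at hj
    exact ⟨j, hj.1.1, rfl, hj.1.2.1, hj.1.2.2, hj.2⟩
  have hrefl : ∀ c ∈ S, ∃ y, FA k A x w c = refl y := by
    intro c hc
    obtain ⟨j, hjA, hjc, -⟩ := hmemS c hc
    exact ⟨x j - w, by rw [← hjc]; exact FA_of_mem A x w j hjA⟩
  have hsep : ∀ c ∈ S, c + 1 ∉ S := by
    intro c hc hc1
    obtain ⟨_, _, _, _, _, h1⟩ := hmemS c hc
    obtain ⟨_, _, _, _, _, h2⟩ := hmemS (c + 1) hc1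
    omega
  have hsites : ∀ c ∈ S, 1 ≤ c ∧ c + 1 ≤ k := by
    intro c hc
    obtain ⟨_, _, _, h1, h2, _⟩ := hmemS c hc
    exact ⟨h1, h2⟩
  have hmain := nrm_evo_le (FA k A x w) (abs_FA_le k A x w) S hrefl hsep k hsites (v0 k A x w)
  have hv0 : nrm (v0 k A x w) ≤ 1 := by
    rw [nrm_eq]
    simp only [v0, z3_01.symm, z3_02.symm, if_true, if_false]
    have := sq_le_one_of_abs_le (abs_FA_le k A x w 0 0)
    nlinarith
  have hpow : (1 / 2 : ℝ) ^ S.card ≤ (1 / 2) ^ 8 :=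
    pow_le_pow_of_le_one (by norm_num) (by norm_num) (by rw [hScard]; exact h8)
  have hsq : (evo k (FA k A x w) (v0 k A x w) w) ^ 2 ≤ ((2 : ℝ) ^ k / 16) ^ 2 := by
    have h1 := sq_le_nrm (evo k (FA k A x w) (v0 k A x w)) w
    have h4 : (4 : ℝ) ^ k = (2 ^ k) ^ 2 := by rw [← pow_mul, mul_comm, pow_mul]; norm_num
    have h0 : (0 : ℝ) ≤ 4 ^ k := by positivity
    have hn := nrm_nonneg (v0 k A x w)
    calc (evo k (FA k A x w) (v0 k A x w) w) ^ 2 ≤ nrm (evo k (FA k A x w) (v0 k A x w)) := h1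
      _ ≤ 4 ^ k * (1 / 2) ^ S.card * nrm (v0 k A x w) := hmain
      _ ≤ 4 ^ k * (1 / 2) ^ 8 * 1 := by
        apply mul_le_mul (mul_le_mul_of_nonneg_left hpow h0) hv0 hn (by positivity)
      _ = ((2 : ℝ) ^ k / 16) ^ 2 := by rw [h4]; ring
  exact abs_le_of_sq_le_sq hsq (by positivity)

/-- **Dense case**: `≥ 16` interior active sites ⇒ `|bbSum| ≤ 3·2^k/16`. -/
theorem abs_bbSum_le_of_dense (k : ℕ) (A : Finset (Fin (k + 1))) (x : Fin (k + 1) → ZMod 3)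
    (h16 : 16 ≤ (interior k A).card) : |bbSum k A x| ≤ 3 * (2 : ℝ) ^ k / 16 := by
  -- one parity class has at least eight members
  have hsplit := card_filter_add_card_filter_not (s := interior k A) (fun j => j.val % 2 = 0)
  have hpar : ∃ par, 8 ≤ ((interior k A).filter fun j => j.val % 2 = par).card := by
    by_cases h0 : 8 ≤ ((interior k A).filter fun j => j.val % 2 = 0).card
    · exact ⟨0, h0⟩
    · refine ⟨1, ?_⟩
      have e : ((interior k A).filter fun j => ¬ (j.val % 2 = 0)) = (interior k A).filter fun j => j.val % 2 = 1 := by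
        ext j; simp only [mem_filter]; constructor <;> rintro ⟨h1, h2⟩ <;> exact ⟨h1, by omega⟩
      rw [e] at hsplit
      omega
  obtain ⟨par, h8⟩ := hpar
  rw [bbSum_eq_sum_evo, sum3]
  have h0 := abs_evo_le_of_parity_class k A x par h8 0
  have h1 := abs_evo_le_of_parity_class k A x par h8 1
  have h2 := abs_evo_le_of_parity_class k A x par h8 2
  calc |evo k (FA k A x 0) (v0 k A x 0) 0 + evo k (FA k A x 1) (v0 k A x 1) 1 + evo k (FA k A x 2) (v0 k A x 2) 2|
      ≤ |evo k (FA k A x 0) (v0 k A x 0) 0 + evo k (FA k A x 1) (v0 k A x 1) 1|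
          + |evo k (FA k A x 2) (v0 k A x 2) 2| := abs_add_le _ _
    _ ≤ |evo k (FA k A x 0) (v0 k A x 0) 0| + |evo k (FA k A x 1) (v0 k A x 1) 1|
          + |evo k (FA k A x 2) (v0 k A x 2) 2| := by gcongr; exact abs_add_le _ _
    _ ≤ 2 ^ k / 16 + 2 ^ k / 16 + 2 ^ k / 16 := by gcongr
    _ = 3 * (2 : ℝ) ^ k / 16 := by ring

/-! ### Sparse case: a free block of `ℓ` consecutive inactive sites -/

/-- The parity core applied to the decoupled main term: for frozen prefix data `p`, site-0 and suffix shifts `r`,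
`Σ_w F^w_0(0) · Π_i F^w_{i+1}(p_i) · Π_i F^w_{i+1+s}(w + r_i) ≥ −1`. -/
theorem sum_prod_FA_ge (k : ℕ) (A : Finset (Fin (k + 1))) (x : Fin (k + 1) → ZMod 3) (a m s : ℕ)
    (p : ℕ → ZMod 3) (r : ℕ → ZMod 3) :
    -1 ≤ ∑ w, FA k A x w 0 0 * (∏ i ∈ range a, FA k A x w (i + 1) (p i))
      * ∏ i ∈ range m, FA k A x w (i + 1 + s) (w + r i) := by
  apply pm_sum_ge
  · intro w
    have h0 := FA_pm k A x w 0 0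
    have h1 := prod_pm_one (range a) (fun i => FA k A x w (i + 1) (p i)) (fun i _ => FA_pm k A x w _ _)
    have h2 := prod_pm_one (range m) (fun i => FA k A x w (i + 1 + s) (w + r i)) (fun i _ => FA_pm k A x w _ _)
    rcases h0 with h0 | h0 <;> rcases h1 with h1 | h1 <;> rcases h2 with h2 | h2 <;>
      rw [h0, h1, h2] <;> norm_num
  · rw [prod_mul_distrib, prod_mul_distrib, prod_FA_const, prod_comm, prod_comm (s := univ)]
    simp_rw [prod_FA_const, prod_FA_shift]
    simp

/-- **Sparse bound**: if the sites `a+1, …, a+ℓ` are inactive and `k = a + ℓ + m`, then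
`bbSum ≥ −2^k/3 − 2·2^{a+m}`. -/
theorem bbSum_ge_of_gap (a ℓ m : ℕ) (A : Finset (Fin (a + ℓ + m + 1))) (x : Fin (a + ℓ + m + 1) → ZMod 3)
    (hgap : ∀ j ∈ A, ¬ (a + 1 ≤ j.val ∧ j.val ≤ a + ℓ)) :
    -((2 : ℝ) ^ (a + ℓ + m) / 3) - 2 * (2 : ℝ) ^ (a + m) ≤ bbSum (a + ℓ + m) A x := by
  rw [bbSum_eq_sum_evo]
  have hFb : ∀ w j z, |FA (a + ℓ + m) A x w j z| ≤ 1 := fun w j z => abs_FA_le _ A x w j z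
  -- the free block: sites `a+1, …, a+ℓ` carry the factor `1`
  have hfree : ∀ w u, evo ℓ (fun j => FA (a + ℓ + m) A x w (j + a)) u = evo ℓ (fun _ _ => 1) u := by
    intro w u
    apply evo_congr
    intro j hj1 hj2
    exact FA_of_not_mem A x w (j + a)
      (fun h hmem => hgap _ hmem ⟨by show a + 1 ≤ j + a; omega, by show j + a ≤ a + ℓ; omega⟩)
  -- decomposition of each endpoint term: main (rank one) + error
  have hdec : ∀ w, evo (a + ℓ + m) (FA (a + ℓ + m) A x w) (v0 (a + ℓ + m) A x w) w
      = 2 ^ ℓ / 3 * (∑ z, evo a (FA (a + ℓ + m) A x w) (v0 (a + ℓ + m) A x w) z)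
          * evo m (fun j => FA (a + ℓ + m) A x w (j + (a + ℓ))) (fun _ => 1) w
        + evo m (fun j => FA (a + ℓ + m) A x w (j + (a + ℓ)))
            (fun z => ∑ z₀, evo a (FA (a + ℓ + m) A x w) (v0 (a + ℓ + m) A x w) z₀
              * (cnt ℓ (z - z₀) - 2 ^ ℓ / 3)) w := by
    intro w
    rw [evo_add (a + ℓ) m, evo_add a ℓ, hfree]
    have hsplit : ∀ u : ZMod 3 → ℝ, evo ℓ (fun _ _ => (1 : ℝ)) u
        = (2 ^ ℓ / 3 * ∑ z, u z) • (fun _ => (1 : ℝ)) + fun z => ∑ z₀, u z₀ * (cnt ℓ (z - z₀) - 2 ^ ℓ / 3) := by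
      intro u
      funext z
      rw [evo_one_eq]
      simp only [Pi.add_apply, Pi.smul_apply, smul_eq_mul, mul_one]
      rw [mul_sum, ← sum_add_distrib]
      refine sum_congr rfl fun z₀ _ => ?_
      ring
    rw [hsplit, evo_add_init, evo_smul_init]
    rfl
  simp_rw [hdec]
  rw [sum_add_distrib]
  -- (1) the error term
  have herr : ∀ w, |evo m (fun j => FA (a + ℓ + m) A x w (j + (a + ℓ)))
      (fun z => ∑ z₀, evo a (FA (a + ℓ + m) A x w) (v0 (a + ℓ + m) A x w) z₀ * (cnt ℓ (z - z₀) - 2 ^ ℓ / 3)) w|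
        ≤ 2 ^ m * (2 / 3 * 2 ^ a) := by
    intro w
    refine abs_evo_le m _ (fun j z => hFb w _ _) _ _ ?_ w
    intro z
    have hl1 := l1_evo_le a (FA (a + ℓ + m) A x w) (fun j z => hFb w j z) (v0 (a + ℓ + m) A x w)
    have hv0 : ∑ z, |v0 (a + ℓ + m) A x w z| ≤ 1 := by
      rw [sum3]
      simp only [v0, z3_01.symm, z3_02.symm, if_true, if_false, abs_zero, add_zero]
      exact hFb w 0 0
    have hdev : ∀ z₀, |cnt ℓ (z - z₀) - 2 ^ ℓ / 3| ≤ 2 / 3 := by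
      intro z₀
      have h := abs_three_cnt_sub_le ℓ (z - z₀)
      have e : cnt ℓ (z - z₀) - 2 ^ ℓ / 3 = (3 * cnt ℓ (z - z₀) - 2 ^ ℓ) / 3 := by ring
      rw [e, abs_div, abs_of_pos (by norm_num : (0:ℝ) < 3)]
      linarith
    calc |∑ z₀, evo a (FA (a + ℓ + m) A x w) (v0 (a + ℓ + m) A x w) z₀ * (cnt ℓ (z - z₀) - 2 ^ ℓ / 3)|
        ≤ ∑ z₀, |evo a (FA (a + ℓ + m) A x w) (v0 (a + ℓ + m) A x w) z₀ * (cnt ℓ (z - z₀) - 2 ^ ℓ / 3)| :=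
          abs_sum_le_sum_abs _ _
      _ = ∑ z₀, |evo a (FA (a + ℓ + m) A x w) (v0 (a + ℓ + m) A x w) z₀| * |cnt ℓ (z - z₀) - 2 ^ ℓ / 3| := by
          simp_rw [abs_mul]
      _ ≤ ∑ z₀, |evo a (FA (a + ℓ + m) A x w) (v0 (a + ℓ + m) A x w) z₀| * (2 / 3) := by
          gcongr with z₀; exact hdev z₀
      _ = (∑ z₀, |evo a (FA (a + ℓ + m) A x w) (v0 (a + ℓ + m) A x w) z₀|) * (2 / 3) := by rw [sum_mul]
      _ ≤ (2 ^ a * 1) * (2 / 3) := by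
          gcongr; exact hl1.trans (by gcongr)
      _ = 2 / 3 * 2 ^ a := by ring
  have herr3 : -(2 * (2 : ℝ) ^ (a + m)) ≤ ∑ w, evo m (fun j => FA (a + ℓ + m) A x w (j + (a + ℓ)))
      (fun z => ∑ z₀, evo a (FA (a + ℓ + m) A x w) (v0 (a + ℓ + m) A x w) z₀ * (cnt ℓ (z - z₀) - 2 ^ ℓ / 3)) w := by
    rw [sum3]
    have h0 := (abs_le.mp (herr 0)).1
    have h1 := (abs_le.mp (herr 1)).1
    have h2 := (abs_le.mp (herr 2)).1
    have e : (2 : ℝ) ^ (a + m) = 2 ^ a * 2 ^ m := pow_add _ _ _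
    rw [e]; linarith
  -- (2) the main term
  have hmain : -((2 : ℝ) ^ (a + ℓ + m) / 3) ≤ ∑ w, 2 ^ ℓ / 3
      * (∑ z, evo a (FA (a + ℓ + m) A x w) (v0 (a + ℓ + m) A x w) z)
      * evo m (fun j => FA (a + ℓ + m) A x w (j + (a + ℓ))) (fun _ => 1) w := by
    have hexp : ∀ w, (∑ z, evo a (FA (a + ℓ + m) A x w) (v0 (a + ℓ + m) A x w) z)
        * evo m (fun j => FA (a + ℓ + m) A x w (j + (a + ℓ))) (fun _ => 1) w
        = ∑ b₁ : Fin a → Bool, ∑ b₂ : Fin m → Bool,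
            FA (a + ℓ + m) A x w 0 0 * (∏ i ∈ range a, FA (a + ℓ + m) A x w (i + 1) (pre a b₁ (i + 1)))
              * ∏ i ∈ range m, FA (a + ℓ + m) A x w (i + 1 + (a + ℓ)) (w + (pre m b₂ (i + 1) - wtZ m b₂)) := by
      intro w
      unfold v0
      rw [sum_evo_delta, evo_ones_apply, sum_mul_sum]
      refine sum_congr rfl fun b₁ _ => sum_congr rfl fun b₂ _ => ?_
      congr 1
      refine prod_congr rfl fun i _ => ?_
      congr 1; ring
    have e1 : ∀ w, 2 ^ ℓ / 3 * (∑ z, evo a (FA (a + ℓ + m) A x w) (v0 (a + ℓ + m) A x w) z)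
        * evo m (fun j => FA (a + ℓ + m) A x w (j + (a + ℓ))) (fun _ => 1) w
        = 2 ^ ℓ / 3 * ((∑ z, evo a (FA (a + ℓ + m) A x w) (v0 (a + ℓ + m) A x w) z)
          * evo m (fun j => FA (a + ℓ + m) A x w (j + (a + ℓ))) (fun _ => 1) w) := by
      intro w; ring
    simp_rw [e1, hexp]
    rw [← mul_sum, sum_comm]
    simp_rw [sum_comm (s := (univ : Finset (ZMod 3))) (t := (univ : Finset (Fin m → Bool)))]
    have hcore : ∀ (b₁ : Fin a → Bool) (b₂ : Fin m → Bool),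
        -1 ≤ ∑ w, FA (a + ℓ + m) A x w 0 0
          * (∏ i ∈ range a, FA (a + ℓ + m) A x w (i + 1) (pre a b₁ (i + 1)))
          * ∏ i ∈ range m, FA (a + ℓ + m) A x w (i + 1 + (a + ℓ)) (w + (pre m b₂ (i + 1) - wtZ m b₂)) :=
      fun b₁ b₂ => sum_prod_FA_ge _ A x a m (a + ℓ) (fun i => pre a b₁ (i + 1))
        (fun i => pre m b₂ (i + 1) - wtZ m b₂)
    have hsum : -((2 : ℝ) ^ a * 2 ^ m) ≤ ∑ b₁ : Fin a → Bool, ∑ b₂ : Fin m → Bool, ∑ w,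
        FA (a + ℓ + m) A x w 0 0
          * (∏ i ∈ range a, FA (a + ℓ + m) A x w (i + 1) (pre a b₁ (i + 1)))
          * ∏ i ∈ range m, FA (a + ℓ + m) A x w (i + 1 + (a + ℓ)) (w + (pre m b₂ (i + 1) - wtZ m b₂)) := by
      have h1 : ∑ b₁ : Fin a → Bool, ∑ b₂ : Fin m → Bool, (-1 : ℝ) = -((2 : ℝ) ^ a * 2 ^ m) := by
        simp only [sum_const, card_univ, Fintype.card_fun, Fintype.card_bool, Fintype.card_fin, nsmul_eq_mul]
        push_cast; ring
      rw [← h1]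
      exact sum_le_sum fun b₁ _ => sum_le_sum fun b₂ _ => hcore b₁ b₂
    have hkpow : (2 : ℝ) ^ (a + ℓ + m) = 2 ^ a * 2 ^ ℓ * 2 ^ m := by rw [pow_add, pow_add]
    rw [hkpow]
    have h2l : (0 : ℝ) < 2 ^ ℓ := by positivity
    nlinarith
  linarith

/-! ### Assembly -/

/-- **The floor** in the `bbSum` form: `bbSum ≥ −(1/3 + ε)·2^k` for `k ≥ 16ℓ + 1`, `2·(1/2)^ℓ ≤ ε`. -/
theorem bbSum_ge (ε : ℝ) (ℓ : ℕ) (hℓ : 2 * (1 / 2 : ℝ) ^ ℓ ≤ ε) (k : ℕ) (hk : 16 * ℓ + 1 ≤ k)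
    (A : Finset (Fin (k + 1))) (x : Fin (k + 1) → ZMod 3) : -(1 / 3 + ε) * (2 : ℝ) ^ k ≤ bbSum k A x := by
  have h2k : (0 : ℝ) < 2 ^ k := by positivity
  have hε : 0 ≤ ε := le_trans (by positivity) hℓ
  by_cases hd : 16 ≤ (interior k A).card
  · have h := abs_bbSum_le_of_dense k A x hd
    have h' := neg_abs_le (bbSum k A x)
    nlinarith
  · rw [not_le] at hd
    -- a free block inside `[1, k-1]`
    obtain ⟨q, hq, hfree⟩ := exists_free_block ((interior k A).image Fin.val) ℓ (card_image_le.trans_lt hd)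
    have hql : q * ℓ + ℓ ≤ 16 * ℓ := by
      have h := Nat.mul_le_mul_right ℓ (Nat.succ_le_of_lt hq)
      rw [Nat.succ_mul] at h
      exact h
    have hgap : ∀ j ∈ A, ¬ (q * ℓ + 1 ≤ j.val ∧ j.val ≤ q * ℓ + ℓ) := by
      intro j hjA hj
      refine hfree j.val ?_ hj
      rw [mem_image]
      exact ⟨j, by rw [interior, mem_filter]; exact ⟨hjA, by omega, by omega⟩, rfl⟩
    obtain ⟨m, hm⟩ : ∃ m, k = q * ℓ + ℓ + m := Nat.exists_eq_add_of_le (hql.trans (by omega))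
    subst hm
    have h := bbSum_ge_of_gap (q * ℓ) ℓ m A x hgap
    have hpow : (2 : ℝ) ^ (q * ℓ + ℓ + m) = 2 ^ (q * ℓ + m) * 2 ^ ℓ := by
      rw [← pow_add]; congr 1; ring
    have hb : 2 * (2 : ℝ) ^ (q * ℓ + m) ≤ ε * 2 ^ (q * ℓ + ℓ + m) := by
      have e : (1 / 2 : ℝ) ^ ℓ * 2 ^ ℓ = 1 := by rw [← mul_pow]; norm_num
      have h2 : (2 : ℝ) ≤ ε * 2 ^ ℓ :=
        calc (2 : ℝ) = (2 * (1 / 2 : ℝ) ^ ℓ) * 2 ^ ℓ := by rw [mul_assoc, e, mul_one]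
          _ ≤ ε * 2 ^ ℓ := by gcongr
      have h0 : (0 : ℝ) ≤ 2 ^ (q * ℓ + m) := by positivity
      calc 2 * (2 : ℝ) ^ (q * ℓ + m) ≤ (ε * 2 ^ ℓ) * 2 ^ (q * ℓ + m) := mul_le_mul_of_nonneg_right h2 h0
        _ = ε * 2 ^ (q * ℓ + ℓ + m) := by rw [hpow]; ring
    linarith

end Summit.QuantumAdvantage.AdviceFreeQNC0.SignWalk

namespace Summit.QuantumAdvantage.QuantumAdvantage.Theorems

open Finset Summit.QuantumAdvantage.AdviceFreeQNC0.SignWalk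

set_option linter.dupNamespace false in
/-- **SIGN-WALK FLOOR on `ℤ₃`** (item stmt-QuantumAdvantage-24332 `SignWalkFloorThree`, route OddPrimeWalk, the route
file's signature verbatim): for `k ≥ k₀(ε)` fair bits with prefix counts `z_j` mod 3, every set `A ⊆ [0,k]` of
active sites and all targets `x_j`, `Σ_b Π_{j ∈ A} (2[z_j + z_k = x_j] − 1) ≥ −(1/3 + ε)·2^k`. -/
theorem oddPrimeWalk_signWalkFloorThree :
    ∀ ε : ℝ, 0 < ε → ∃ k₀ : ℕ, ∀ k ≥ k₀, ∀ A : Finset (Fin (k + 1)), ∀ x : Fin (k + 1) → ZMod 3, -(1 / 3 + ε) * (2 : ℝ) ^ k ≤ ∑ b : Fin k → Bool, ∏ j ∈ A, (if (((Finset.univ.filter fun i : Fin k => i.val < j.val ∧ b i = true).card : ℕ) : ZMod 3) + (((Finset.univ.filter fun i : Fin k => b i = true).card : ℕ) : ZMod 3) = x j then (1 : ℝ) else -1) := by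
  intro ε hε
  obtain ⟨ℓ, hℓ⟩ := exists_pow_lt_of_lt_one (half_pos hε) (by norm_num : (1 / 2 : ℝ) < 1)
  refine ⟨16 * ℓ + 1, fun k hk A x => ?_⟩
  exact bbSum_ge ε ℓ (by linarith) k hk A x

end Summit.QuantumAdvantage.QuantumAdvantage.Theorems
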